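import Mathlib
import HarnessLib
import HarnessLib.Audit
import Summits.MatrixMultiplication.Statement
import Literature.Computability.AlgebraicComplexity.AsymptoticSpectrum
import Literature.Computability.AlgebraicComplexity.AsymptoticRankMatMul
import Literature.Computability.AlgebraicComplexity.FlatteningBound
import HarnessLib.Audit.Status.Attr

/-!
Route: HenselReesLifting

DORMANT since 2026-08-22T16:36:33Z (reconciler: no traction for 5.5 d (last activity item-evidence-added at 2026-08-17T04:17:29Z); parked, not closed — `ledger route dormant route-MatrixMultiplication-HenselReesLifting --off` to reactiv) — unstaffed, not closed; items shared with open routes are served there. `ledger route dormant <id> --off` reactivates.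

# Route HenselReesLifting — omega = 2 iff the 2-adic lift to the exterior algebra and the Rees lift
to Clifford are padding-free

It suffices to show X = A ∧ B for the structure tensors on the Boolean cube (basis e_S, S ⊆ [n];
entry (U,S,T) =
coefficient of e_U in e_S·e_T): T_{Λ_n}(U,S,T) = [S∩T = ∅][U = S∪T]·(−1)^{inv(S,T)} (exterior
algebra, inv(S,T) = the
number of pairs (s,t) ∈ S×T with t < s) and T_{Cl_n}(U,S,T) = [U = S Δ T]·(−1)^{inv(S,T)} (Clifford
algebra, e_i² = 1, Cl_{2k} ≅
M_{2^k}(ℂ)). A = ExteriorExponentOne ("e_Λ = 1"): for every ε > 0 and all large n the asymptotic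
rank R~(T_{Λ_n}) ≤
2^{(1+ε)n}. B = CliffordReduction ("ω ≤ 2·e_Λ"): for every ε > 0 and all large n, R~(T_{Cl_n}) ≤
2^{εn}·R~(T_{Λ_n}).
Realises card hensel-rees-obstruction-calculus: both halves are LIFTING problems for tensor
decompositions out of a
solved special fibre — mod 2 the fermionic sign is invisible, T_{Λ_n} ⊗ F_2 = T_{D_n} ⊗ F_2 with D_n
= (F[x]/x²)^{⊗n} of
rank ≤ (n+1)(n+2)/2·2^n over ℤ (2-adic Hensel lift, crux HenselLiftExterior ⇒ A), and Cl_n is the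
Rees deformation
e_S·e_T = t^{|S∩T|}(−1)^{inv}e_{SΔT} of Λ_n (t-adic lift over ℂ[[t]], crux ReesLiftClifford ⇒ B).
Lean: `(∀ ε : ℝ, 0 < ε → ∀ᶠ n : ℕ in Filter.atTop,
Literature.Computability.AlgebraicComplexity.asymptoticRank (fun U S T : Finset (Fin n) => if
Disjoint S T ∧ U = S ∪ T then (-1 : ℂ) ^ ((S ×ˢ T).filter (fun p : Fin n × Fin n => p.2 < p.1)).card
else 0) ≤ (2 : ℝ) ^ ((1 + ε) * n)) ∧ (∀ ε : ℝ, 0 < ε → ∀ᶠ n : ℕ in Filter.atTop,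
Literature.Computability.AlgebraicComplexity.asymptoticRank (fun U S T : Finset (Fin n) => if U =
symmDiff S T then (-1 : ℂ) ^ ((S ×ˢ T).filter (fun p : Fin n × Fin n => p.2 < p.1)).card else 0) ≤
(2 : ℝ) ^ (ε * n) * Literature.Computability.AlgebraicComplexity.asymptoticRank (fun U S T : Finset
(Fin n) => if Disjoint S T ∧ U = S ∪ T then (-1 : ℂ) ^ ((S ×ˢ T).filter (fun p : Fin n × Fin n =>
p.2 < p.1)).card else 0))`

## Assembly
Bookkeeping from PROVED cone facts: for k large, (2^k)^ω ≤ R~(⟨2^k,2^k,2^k⟩)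
(rpow_omega_le_asymptoticRank_matMulTensor)
≤ R~(T_{Cl_{2k}}) (CliffordMatrixModel + TensorRestrictsTo.polyDegeneratesTo +
asymptoticRank_le_of_polyDegeneratesTo)
≤ 2^{2kε}·R~(T_{Λ_{2k}}) (CliffordReduction) ≤ 2^{2kε}·2^{(1+ε)2k} (ExteriorExponentOne) =
(2^k)^{2+4ε}; logarithms give
ω ≤ 2 + 4ε for every ε > 0, hence ω ≤ 2, and omega_two_le gives ω(ℂ) = 2.

Rationale: WHY THIS LINE. Four algebras share the combinatorics of the Boolean cube — the group algebra
ℂ[F_2^n], the commutative twin D_n =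
(ℂ[x]/x²)^{⊗n} (minimal border rank 2^n), the exterior algebra Λ_n and the Clifford algebra Cl_n ≅
M_{2^{n/2}}(ℂ) — and
they are joined by two one-parameter deformations out of a SOLVED model: 2-adically, T_{Λ_n} is a
lift of T_{D_n} ⊗ F_2
(at p = 2 the sign (−1)^{inv} dies; arXiv:1804.09448 §4 records the same collapse as "exterior
algebra = Koutis' group
algebra in characteristic two"), and t-adically Cl_n is the Rees/PBW quantisation of Λ_n
(Chevalley). The card's
obstruction calculus — a decomposition over the residue ring extends one order iff a
lift-independent class in the
Terracini normal space coker dΦ_D vanishes, padding by r′ dummy terms absorbs any correction of rank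
≤ r′ — is the common
tool; Kauers–Moosbauer apply exactly this Hensel step scheme-by-scheme to F_2 matrix-multiplication
schemes
(arXiv:2212.01175 p.10: none of >10^5 rank-47 ⟨4,4,4⟩ schemes lifts to ℤ/4, a rank-97 ⟨5,5,5⟩ scheme
lifts to ℤ) and
observe that liftability is a property of the rank LEVEL, which an asymptotic statement can buy with
2^{o(n)} padding.
Imported areas: p-adic/formal deformation theory of solution varieties of the Brent equations
(Hensel, Artin), filtered
deformations Λ ⇝ Cl (Clifford theory, CAR algebra: fermionise = signs, quantise = contractions), and
the parameterised-
algorithms literature where the cost of one wedge product is an explicit bottleneck (3^n trivially,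
O*(2^{ωn/2}) via
Clifford: Leopardi 2005, Włodarczyk arXiv:1609.07134, Brand–Dell–Husfeldt arXiv:1804.09448 p.7).
What no prior route
does: every open route here works over ℂ with secant equations, spectra, designs or STPP; none
changes characteristic or
deforms decompositions, and none names the intermediate exponent e_Λ := limsup log₂R~(T_{Λ_n})/n ∈
[1, ω/2], for which
EITHER answer is new (e_Λ < ω/2 separates wedge products from matrix products; e_Λ = 1 is an
asymptotic-rank-conjecture
instance for a non-smoothable algebra). The card's mixed-characteristic twin for ⟨n,n,n⟩ itself
(ω(Q̄) = ω(F̄_p)) is left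
to the sibling card modular-heisenberg-transfer, where it is load-bearing; here the special fibre is
already solved, so no
characteristic-p proof of ω = 2 is needed.

RANKED CRUXES. #0 XThesis (target) — X = ExteriorExponentOne ∧ CliffordReduction (e_Λ = 1 and ω ≤
2e_Λ), inlined. (why it might fail: A ∧ B is EQUIVALENT to ω = 2 given the cone (ω = 2 ⇒
R(T_{Cl_{2k}}) = 4^{k(1+o(1))} ⇒ both), so exactly one half is as hard as the summit; the bet is
that the split e_Λ = 1 / ω ≤ 2e_Λ isolates two lifting problems with different tools.)
[arXiv:1804.09448, arXiv:1609.07134, arXiv:2212.01175, BurgisserClausenShokrollahi1997]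
#2 ExteriorExponentOne (crux) — e_Λ = 1: for every ε > 0 and all large n, the asymptotic rank
(Kronecker powers, over ℂ) of the exterior-algebra tensor T_{Λ_n} on the 2^n-point Boolean cube is ≤
2^{(1+ε)n} (card item N3a). Known frame: 2^n ≤ R~(T_{Λ_n}) (flattening: unital algebra) and
R~(T_{Λ_n}) ≤ bR(T_{Λ_n}) ≤ R(T_{Cl_n}) = 2^{(ω/2)n + o(n)} (Λ_n = gr Cl_n is a degeneration of
Cl_n), i.e. 1 ≤ e_Λ ≤ ω/2 < 1.186; bR(T_{Λ_n}) ≥ 2^n + 1 for n ≥ 2 (non-commutative ⇒ not smoothable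
⇒ not of minimal border rank), bR(T_{Λ_2}) = 5 (T_{Λ_2} and T_{D_2} differ by one triad). No known
spectral point exceeds 2^n on T_{Λ_n} (its support is that of W^{⊠n}; support = quantum functionals
give 2^n), so nothing in the cone obstructs it. [difficulty: open-problem] (why it might fail: Λ_n
is non-smoothable with Q~(T_{Λ_n}) ≤ 2^{0.9183n} (irreversible), so no duality/degeneration
shortcut; the fermionic sign may cost a fixed exponent — e_Λ could equal ω/2 (wedge = matrix
product), and no upper bound below 2^{ωn/2} is known (arXiv:1804.09448 p.7).) [arXiv:1804.09448,
arXiv:1609.07134, BlaserLysikov2016, BlaserLysikov2020, ChristandlVranaZuiddam2023, Landsberg2017]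
#3 CliffordReduction (crux) — ω ≤ 2·e_Λ in concrete form: for every ε > 0 and all large n,
R~(T_{Cl_n}) ≤ 2^{εn}·R~(T_{Λ_n}) — matrix multiplication (Cl_{2k} ≅ M_{2^k}(ℂ), so R~(T_{Cl_{2k}})
= 2^{kω}) reduces at the exponent scale to one wedge product (card item N3b read as an exponent
inequality). The intended proof is NOT a degeneration (impossible, see Barriers) but the Rees lift
of crux ReesLiftClifford: deform decompositions of T_{Λ_n}^{⊠N} along e_S·e_T = t^{|S∩T|}(−1)^{inv}
e_{SΔT}; first order is free up to padding (the signed single-contraction part μ_1 is a sum of n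
tensors each GL-equivalent to T_{Λ_{n−1}}), the crux is the quadratic feedback at orders ≥ 2.
[difficulty: open-problem] (why it might fail: rank jumps UP from special to generic fibre
generically; with e_Λ = 1 this item alone is ω = 2. Per-order padding factors C_j ≥ C > 1 at every
order would give only ω ≤ 2e_Λ + 2log₂C (naive C = 4, card); no reduction from matrices to wedge
products is known (arXiv:1609.07134).) [arXiv:1609.07134, arXiv:1804.09448, BlaserLysikov2020,
ChristandlVranaZuiddam2021, BurgisserClausenShokrollahi1997]
#4 HenselLiftExterior (crux) — 2-adic Hensel lifting with sub-exponential padding (card items N1/B1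
transplanted to the exterior algebra, where the special fibre is solved): for every ε > 0 and all
large n there is N ≥ 1 with R_{Z̄_2}(T_{Λ_n}^{⊠N}) ≤ 2^{(1+ε)nN}, the rank taken over the valuation
ring Z̄_2 of Q̄_2 (2-adically integral decompositions; their reductions are F̄_2-decompositions of
T_{D_{nN}} ⊗ F_2, which exist in rank ≤ (nN+1)(nN+2)/2·2^{nN}). Mechanism: lift order by order 2^s →
2^{s+1}; the obstruction at each order is the class of (T_Λ − Φ(D̃))/2^s in coker dΦ_D over the
residue field, killed by re-choosing lower-order lifts and by padding; implies ExteriorExponentOne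
(support HenselToExponent). [difficulty: XL] (why it might fail: finite-level obstructions are real
and level-dependent (arXiv:2212.01175 p.10: 0 of >10^5 rank-47 ⟨4,4,4⟩ F_2-schemes lift to ℤ/4);
near-optimal F̄_2-decompositions of T_{D} may all be obstructed toward T_Λ with a uniform exponent
gap, even though e_Λ = 1 holds via non-integral decompositions.) [arXiv:2212.01175,
doi:10.1038/s41586-022-05172-4, arXiv:1905.10192, BurgisserClausenShokrollahi1997, arXiv:1804.09448]
#5 ReesLiftClifford (crux) — t-adic (Rees) lifting with sub-exponential padding: for every ε > 0,
all large n and all large N, the rank over ℂ[[t]] of the N-th Kronecker power of the Rees tensor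
T_t(U,S,T) = [U = SΔT]·t^{|S∩T|}(−1)^{inv(S,T)} (special fibre T_{Λ_n} at t = 0, generic fibre ≅
T_{Cl_n}) is ≤ 2^{εnN}·R_ℂ(T_{Λ_n}^{⊠N}). Implies CliffordReduction by coefficient extraction
(support ReesToReduction: a ℂ[[t]]-decomposition of a degree-D polynomial tensor yields ≤
(D+1)(D+2)/2 triads per term for its value at t = 1). [difficulty: XL] (why it might fail: optimal
decompositions of T_{Λ_n}^{⊠N} sit at very singular points of the secant variety where coker dΦ_D is
huge; the order-2 feedback Φ''(D_1,D_1) need not be low-rank modulo the Terracini space for ANY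
choice of D_1, forcing padding 2^{cnN}, c > 0.) [BurgisserClausenShokrollahi1997, Landsberg2017,
BlaserLysikov2016, arXiv:1609.07134]
#9 CliffordMatrixModel (support) — Cl_{2k}(ℂ) ≅ M_{2^k}(ℂ) at tensor level: T_{Cl_{2k}} restricts to
⟨2^k,2^k,2^k⟩ (Jordan–Wigner / Pauli strings e_{2j−1} ↦ Z^{⊗(j−1)}⊗X⊗1^{⊗(k−j)}, e_{2j} ↦
Z^{⊗(j−1)}⊗Y⊗1^{⊗(k−j)}; an algebra isomorphism transports structure tensors by (φ, φ⁻ᵀ, φ⁻ᵀ)).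
Gives R~(⟨2^k,2^k,2^k⟩) ≤ R~(T_{Cl_{2k}}) by asymptoticRank_le_of_polyDegeneratesTo (PROVED in
tree). [difficulty: provable-now] [Chevalley1951, arXiv:1609.07134, Blaser2013]
#9 SpecialFibreSolved (support) — the special fibre is solved: over F_2 the reduction of T_{Λ_n}
(all signs +1, i.e. T_{D_n} ⊗ F_2 = W^{⊠n}) has rank ≤ (n+1)(n+2)/2·2^n. Proof: εT_{D_1} +
ε²e_{x;x,x} = (ε,−1)⊗(1,0)⊗(1,0) + (0,1)⊗(1,ε)⊗(1,ε) over ℤ[ε] (order-1 approximate decomposition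
with 2 triads, from ℤ[x]/(x²−εx) ≅ ℤ[1/ε]²); take the n-th Kronecker power and extract the ε^n
coefficient: Σ_{a+b≤n} w_a⊗u_b⊗v_{n−a−b} per product triad; map ℤ → ZMod 2 (tensorRank_map_le,
PROVED). [difficulty: provable-now] [BurgisserClausenShokrollahi1997, Landsberg2017, Blaser2013]
#9 HenselToExponent (support) — HenselLiftExterior → ExteriorExponentOne: push a Z̄_2-decomposition
along Z̄_2 ⊂ Q̄_2 ≃+* ℂ (tree:
Literature.NumberTheory.GaloisRepresentations.NumberField.nonempty_algebraicClosure_padic_ringEquiv_complex,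
PROVED; tensorRank_map_le, PROVED; the image of T_{Λ_n} is T_{Λ_n} since entries are 0, ±1, and
kroneckerPow commutes with ring maps), then R~(t) ≤ R(t^{⊠N})^{1/N} (asymptoticRank_le_rpow,
PROVED). [difficulty: provable-now] [BurgisserClausenShokrollahi1997, Blaser1999]
#9 ReesToReduction (support) — ReesLiftClifford → CliffordReduction: a rank-r decomposition over
ℂ[[t]] of a tensor whose entries are polynomials of degree ≤ D = nN gives, by comparing coefficients
of t^j (j ≤ D) and regrouping Σ_{a+b≤D} w_a⊗u_b⊗(Σ_{c≤D−a−b} v_c), a decomposition of its value at t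
= 1 — which is T_{Cl_n}^{⊠N} — with ≤ (D+1)(D+2)/2·r triads (Bini's argument, valid over any ring);
then N-th roots and the Fekete limit advxxz2025_asymptoticRank_tendsto (PROVED) on both sides,
(nN+2)^{2/N} → 1. [difficulty: provable-now] [BurgisserClausenShokrollahi1997, Blaser2013,
AlmanDuanVassilevskaWilliamsXuXuZhou2025]

TWO-LAYER PLAN. Foreseen glued splits (k ≤ 3, depth 1), filed only when a crux closes or stalls with
a census:
ExteriorExponentOne ⇐ HenselLiftExterior → HenselToExponent → ExteriorExponentOne is already wired
(support); if
HenselLiftExterior stalls, split it as FirstOrderLift (the order-1 obstruction class of the explicit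
ℤ-decomposition of
T_{D_n}, an F_2-linear problem, vanishes after padding n·2^n) → HigherOrderControl (per-order
padding factors C_s with
Π C_s = 2^{o(n)}) → HenselLiftExterior. CliffordReduction ⇐ ReesLiftClifford → ReesToReduction is
wired; split of
ReesLiftClifford as ReesFirstOrder (bR(μ_1) ≤ 2n·R: free) → QuadraticFeedback (orders ≥ 2) →
ReesLiftClifford. A third
natural child of either lift is the odd prime variant (p odd: Cl_n ⊗ F̄_p ≅ M_{2^{n/2}}(F̄_p), so
e_Λ(F̄_p) and ω(F̄_p)
enter) — only if the sibling modular-heisenberg route lands its characteristic transfer.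

KILL CRITERIA. Refutation of CliffordReduction (a proof that ω > 2e_Λ, e.g. e_Λ = 1 with any ω > 2
lower bound — far beyond current
technique) closes the route `refuted:CliffordReduction`; refutation of ExteriorExponentOne
(R~(T_{Λ_n}) ≥ 2^{(1+c)n}
along a subsequence: a super-multiplicative lower bound on an explicit free tensor beyond every
known spectral point)
closes it `refuted:ExteriorExponentOne` and is itself a landmark (wedge products strictly harder
than their support).
Refutation of HenselLiftExterior or ReesLiftClifford alone forces a pivot, not a close: the exponent
cruxes survive with
non-integral / non-formal decompositions; pivot to the odd-prime variant or to direct border-rank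
constructions for
T_{Λ_n}. ω = 2 proved on any other route moots the route but PROVES all four cruxes' exponent
content (X ⟺ ω = 2).
Certified data bR(T_{Λ_n})/2^n increasing fast for n = 2..5 (5/4 at n = 2) demotes rank 2 below rank
3.

NOT DECOMPOSED YET. The card's mixed-characteristic theses for ⟨n,n,n⟩ itself — N1: ω(Q̄) ≤ ω(F̄_p)
by p-adic lifting of near-optimal
F̄_p-decompositions of ⟨n,n,n⟩^{⊗k} with padding n^{o(k)}, N2: p-integral models (ω(F̄_p) ≤ ω(Q̄)) —
are deliberately
NOT items here: they pay off only together with a characteristic-p proof of ω(F̄_p) = 2, which is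
the sibling card
modular-heisenberg-transfer's crux; if that route opens, N1 is filed there (or here as support) with
signature
`∀ p, p.Prime → omega ℂ ≤ omega (AlgebraicClosure (ZMod p))`. Also not decomposed: the per-order
constants C_s of both
lifts, the choice of the base decomposition D of T_{D_n} (the lift depends on D only through its
Terracini space), the
odd-n Clifford case (Cl_{2k+1} ≅ M ⊕ M, irrelevant to the assembly), named definitions for the three
inlined tensors.

CHEAPEST FALSIFIER. Pure F_2-linear algebra, kit-sized: take the explicit ℤ-decomposition D̃ of
T_{D_n} (rank ≤ (n+1)(n+2)/2·2^n, or the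
(n+1)·2^n-type decompositions of W^{⊠n}), n = 3,…,8, pad with r′ ∈ {0, 2^n, n·2^n} zero triads, and
solve the order-1
Hensel system dΦ_D(δ) ≡ (T_{Λ_n} − Φ(D̃))/2 (mod 2) — the right-hand side is the 0/1 tensor of
disjoint pairs (S,T) with
inv(S,T) odd; ≤ 3·(r+r′)·2^n unknowns (n = 6: < 10^5, sparse). Persistent insolubility for every
padding ≤ n·2^n and
every n is strong evidence against HenselLiftExterior (not a refutation: other base decompositions
exist); solubility
to order s = 20 followed by rational reconstruction (arXiv:2212.01175 p.10 recipe) would hand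
explicit small-rank
ℚ-decompositions of T_{Λ_n}, i.e. direct data on e_Λ. Second check: certified bR(T_{Λ_3}) (8×8×8,
Koszul flattenings)
against 9. Not run in this planner unit (compute-free hub, no kit in plancard mode); it is the first
refuter job.

NUMBERS. ω(ℂ) < 2.371339 (AlmanDuanVassilevskaWilliamsXuXuZhou2025), hence 1 ≤ e_Λ ≤ ω/2 < 1.1857;
trivial wedge product 3^n
operations, best O*(2^{ωn/2}) (arXiv:1804.09448 p.7, arXiv:1609.07134). bR(T_{Λ_n}) ≥ 2^n + 1 (n ≥
2, BlaserLysikov2016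
p.5/p.7: smoothable ⇒ commutative; unital minimal border rank ⇔ smoothable), bR(T_{Λ_2}) = 5
(T_{Λ_2} = T_{D_2} − 2·e_{ab}⊗b*⊗a*, one triad off a border-rank-4 tensor).
Q~(T_{Λ_n}) ≤ 2^{h(1/3)n} = 2^{0.9183n} (Strassen's upper support functional θ = (1/3,1/3,1/3)
evaluated on the
W^{⊠n}-support, Strassen1991, ChristandlVranaZuiddam2023), so irreversibility ≥ 1.089 and
any degeneration-based bound through T_{Λ_n} is ≥ 2.178 (ChristandlVranaZuiddam2021). Hensel
statistics
(arXiv:2212.01175 p.10): ⟨4,4,4⟩ rank 47: 0 of >10^5 schemes lift ℤ_2 → ℤ_4; ⟨5,5,5⟩ rank 95: 0 of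
>3·10^4; rank 97
lifts to ℤ; ⟨4,4,5⟩ rank 60: none, rank 62: some. Special fibre: R_{F_2}(T_{D_n}) ≤
(n+1)(n+2)/2·2^n. Items at open: 10.

DEFINITION REQUESTS. None required (the three Boolean-cube tensors are inlined lambdas over `Finset
(Fin n)`; `asymptoticRank`,
`kroneckerPow`, `TensorRestrictsTo`, `tensorRank` over `CommSemiring` — hence over
`(PadicAlgCl.valued 2).v.integer`,
`PowerSeries ℂ`, `ZMod 2` — exist). Nice-to-have, to be filed against the rank-2 item after open:
named
`exteriorTensor K n`, `cliffordTensor K n`, `reesCliffordTensor n` in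
Literature/Computability/AlgebraicComplexity with
the lemmas "map along a ring hom", "t = 0 / t = 1 specialisations", "mod 2 all three coincide with
W^{⊠n}".

Novelty: Searches (2026-08-15): `lit search --hybrid "exterior algebra Clifford algebra multiplication
complexity tensor rank"`
(10 docs: Landsberg2017, BCS1997 — grep Clifford|exterior algebra: only Clifford THEORY of
characters pp.373–375 —,
Garling 2011, Greub 1978, no complexity of Λ/Cl structure tensors); `lit search --source zbmath
"Clifford algebra fast
multiplication"` (3: Cariow–Cariowa 2015 Pauli numbers, irrelevant), `--source zbmath "exterior
algebra multiplication
bilinear complexity"` (0); `--source crossref "Hensel lifting matrix multiplication schemes"` (8,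
only flip-graph papers
doi:10.1145/3747199.3747566, doi:10.1109/synasc69064.2025.00015); `lit galaxy search "exterior
algebra multiplication
complexity" --star all` (0 rows; pdf star timed out); `lit frontier MatrixMultiplication --since
2022` (30 rows; relevant:
arXiv:2602.13171 complex→rational = extension direction only, arXiv:2601.21553 support = quantum
functionals); `lit read`
with grep of arXiv:2212.01175 (p.10), arXiv:1804.09448 (p.7, §4), arXiv:1609.07134 (pp.4,10),
arXiv:1606.04253 (pp.5,7),
BCS pp.417–418; arXiv/OpenAlex/S2 APIs rate-limited (429) during this pass; the card's refuter audit
ran zbMATH "tensor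
rank positive characteristic exponent" (0) and "Hensel lifting matrix multiplication" (0 relevant).
Nearest prior art found: arXiv:2212.01175 (scheme-by-scheme Hensel lifting ℤ_2 → ℤ_4 → ℤ of
matrix-multiplication
schemes as search post-processing); arXiv:1609.07134 / arXiv:1804.09448 (one wedge produ  [refs: 10.1145/3747199.3747566, 10.1109/synasc69064.2025.00015, 2602.13171, 2601.21553, 2212.01175, 1804.09448, 1609.07134, 1606.04253, doi:10.1145/3747199.3747566, doi:10.1109/synasc69064.2025.00015, Landsberg2017, BurgisserClausenShokrollahi1997, BlaserLysikov2016]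

Barriers (technique_class: hensel-lifting, deformation-of-decompositions, char-transfer): - technique_class: hensel-lifting, deformation-of-decompositions, char-transfer
- Literature.Barriers.MatrixMultiplication.UnstableTensorBarrier: T_{Λ_n} is
unstable/non-semisimple, but it is never an intermediate tensor whose powers RESTRICT to ⟨m,m,m⟩;
matrices enter through the semisimple Cl_{2k} ≅ M_{2^k} exactly, Λ_n → Cl_n goes by deforming
decompositions up the Rees family (special → generic fibre, not a map of tensors), and n → ∞
(growing family, the barrier's own evasion (i)).
- Literature.Barriers.MatrixMultiplication.IrreversibilityBarrier: quantitatively confirms the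
design: Q~(T_{Λ_n}) ≤ 2^{0.9183n} makes T_{Λ_n} irreversible (≥ 1.089), so any bound on ω via
degenerations of T_{Λ_n}^{⊠N} is ≥ 2.178 — CliffordReduction can only be proved by lifting
(upper-semicontinuity beaten order by order), which certifies no relative exponent of a fixed
tensor; outside the class. The bet is exactly that lifting is not degeneration.
- Literature.Barriers.MatrixMultiplication.UniversalMethodBarrier: same remark; no fixed
intermediate tensor, no asymptotic-rank × relative-exponent certificate.
- Literature.Barriers.MatrixMultiplication.InfimumNotMinimumBarrier: respected — every item is ∀ε /
eventually-in-n / Kronecker-asymptotic; a successful finite lift only moves data, never certifies ω.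
- Literature.Barriers.MatrixMultiplication.LinearRankMethodBarrier: concerns lower bounds by
determinantal equations; only the NEGATIONS of ranks 2–3 would need lower bounds (and would need to

History (route lifecycle, newest last):
- 2026-08-22T16:36:33Z · DORMANT — reconciler: no traction for 5.5 d (last activity item-evidence-added at 2026-08-17T04:17:29Z); parked, not closed — `ledger route dormant route-MatrixMultiplica (operator:999:2682294)

sub-problem: MatrixMultiplication · status: dormant · opened planner-plancard-MatrixMultiplication-MatrixM-59293796-0 2026-08-15T11:25:23Z · rev 1 · ledger route-MatrixMultiplication-HenselReesLifting
GENERATED by the gate from the ledger (D-0016/17). Provers cite these decls: `theorem foo : Summit.MatrixMultiplication.MatrixMultiplication.Theses.HenselReesLifting.<Decl> := …` in Summits/MatrixMultiplication/MatrixMultiplication/Theorems/<Name>.lean.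
-/

namespace Summit.MatrixMultiplication.MatrixMultiplication.Theses.HenselReesLifting

open scoped BigOperators Topology Manifold Classical MeasureTheory ProbabilityTheory Matrix InnerProductSpace ComplexConjugate ContinuousMap
open Filter Set Function TopologicalSpace MeasureTheory

attribute [summit_statement] _root_.MatrixMultiplication

/-- item stmt-MatrixMultiplication-3849 · target · rank 0 · open · by planner
why it might fail: A ∧ B is EQUIVALENT to ω = 2 given the cone (ω = 2 ⇒ R(T_{Cl_{2k}}) = 4^{k(1+o(1))} ⇒ both), so exactly one half is as hard as the summit; the bet is that the split e_Λ = 1 / ω ≤ 2e_Λ isolates two lifting problems with different tools.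
sources: arXiv:1804.09448, arXiv:1609.07134, arXiv:2212.01175, BurgisserClausenShokrollahi1997
[target] X = ExteriorExponentOne ∧ CliffordReduction (e_Λ = 1 and ω ≤ 2e_Λ), inlined. -/
@[route_item "route-MatrixMultiplication-HenselReesLifting"]
def XThesis : Prop :=
  (∀ ε : ℝ, 0 < ε → ∀ᶠ n : ℕ in Filter.atTop, Literature.Computability.AlgebraicComplexity.asymptoticRank (fun U S T : Finset (Fin n) => if Disjoint S T ∧ U = S ∪ T then (-1 : ℂ) ^ ((S ×ˢ T).filter (fun p : Fin n × Fin n => p.2 < p.1)).card else 0) ≤ (2 : ℝ) ^ ((1 + ε) * n)) ∧ (∀ ε : ℝ, 0 < ε → ∀ᶠ n : ℕ in Filter.atTop, Literature.Computability.AlgebraicComplexity.asymptoticRank (fun U S T : Finset (Fin n) => if U = symmDiff S T then (-1 : ℂ) ^ ((S ×ˢ T).filter (fun p : Fin n × Fin n => p.2 < p.1)).card else 0) ≤ (2 : ℝ) ^ (ε * n) * Literature.Computability.AlgebraicComplexity.asymptoticRank (fun U S T : Finset (Fin n) => if Disjoint S T ∧ U = S ∪ T then (-1 : ℂ) ^ ((S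 ×ˢ T).filter (fun p : Fin n × Fin n => p.2 < p.1)).card else 0))

/-- item stmt-MatrixMultiplication-3850 · crux · rank 2 · open · by planner
why it might fail: Λ_n is non-smoothable with Q~(T_{Λ_n}) ≤ 2^{0.9183n} (irreversible), so no duality/degeneration shortcut; the fermionic sign may cost a fixed exponent — e_Λ could equal ω/2 (wedge = matrix product), and no upper bound below 2^{ωn/2} is known (arXiv:1804.09448 p.7).
sources: arXiv:1804.09448, arXiv:1609.07134, BlaserLysikov2016, BlaserLysikov2020, ChristandlVranaZuiddam2023, Landsberg2017
[crux] e_Λ = 1: for every ε > 0 and all large n, the asymptotic rank (Kronecker powers, over ℂ) of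
the exterior-algebra tensor T_{Λ_n} on the 2^n-point Boolean cube is ≤ 2^{(1+ε)n} (card item N3a).
Known frame: 2^n ≤ R~(T_{Λ_n}) (flattening: unital algebra) and R~(T_{Λ_n}) ≤ bR(T_{Λ_n}) ≤
R(T_{Cl_n}) = 2^{(ω/2)n + o(n)} (Λ_n = gr Cl_n is a degeneration of Cl_n), i.e. 1 ≤ e_Λ ≤ ω/2 <
1.186; bR(T_{Λ_n}) ≥ 2^n + 1 for n ≥ 2 (non-commutative ⇒ not smoothable ⇒ not of minimal border
rank), bR(T_{Λ_2}) = 5 (T_{Λ_2} and T_{D_2} differ by one triad). No known spectral point exceeds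
2^n on T_{Λ_n} (its support is that of W^{⊠n}; support = quantum functionals give 2^n), so nothing
in the cone obstructs it. [difficulty: open-problem] -/
@[route_item "route-MatrixMultiplication-HenselReesLifting", crux]
def ExteriorExponentOne : Prop :=
  ∀ ε : ℝ, 0 < ε → ∀ᶠ n : ℕ in Filter.atTop, Literature.Computability.AlgebraicComplexity.asymptoticRank (fun U S T : Finset (Fin n) => if Disjoint S T ∧ U = S ∪ T then (-1 : ℂ) ^ ((S ×ˢ T).filter (fun p : Fin n × Fin n => p.2 < p.1)).card else 0) ≤ (2 : ℝ) ^ ((1 + ε) * n)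

/-- item stmt-MatrixMultiplication-3851 · crux · rank 3 · open · by planner
why it might fail: rank jumps UP from special to generic fibre generically; with e_Λ = 1 this item alone is ω = 2. Per-order padding factors C_j ≥ C > 1 at every order would give only ω ≤ 2e_Λ + 2log₂C (naive C = 4, card); no reduction from matrices to wedge products is known (arXiv:1609.07134).
sources: arXiv:1609.07134, arXiv:1804.09448, BlaserLysikov2020, ChristandlVranaZuiddam2021, BurgisserClausenShokrollahi1997
[crux] ω ≤ 2·e_Λ in concrete form: for every ε > 0 and all large n, R~(T_{Cl_n}) ≤
2^{εn}·R~(T_{Λ_n}) — matrix multiplication (Cl_{2k} ≅ M_{2^k}(ℂ), so R~(T_{Cl_{2k}}) = 2^{kω})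
reduces at the exponent scale to one wedge product (card item N3b read as an exponent inequality).
The intended proof is NOT a degeneration (impossible, see Barriers) but the Rees lift of crux
ReesLiftClifford: deform decompositions of T_{Λ_n}^{⊠N} along e_S·e_T = t^{|S∩T|}(−1)^{inv} e_{SΔT};
first order is free up to padding (the signed single-contraction part μ_1 is a sum of n tensors each
GL-equivalent to T_{Λ_{n−1}}), the crux is the quadratic feedback at orders ≥ 2. [difficulty:
open-problem] -/
@[route_item "route-MatrixMultiplication-HenselReesLifting", crux]
def CliffordReduction : Prop :=
  ∀ ε : ℝ, 0 < ε → ∀ᶠ n : ℕ in Filter.atTop, Literature.Computability.AlgebraicComplexity.asymptoticRank (fun U S T : Finset (Fin n) => if U = symmDiff S T then (-1 : ℂ) ^ ((S ×ˢ T).filter (fun p : Fin n × Fin n => p.2 < p.1)).card else 0) ≤ (2 : ℝ) ^ (ε * n) * Literature.Computability.AlgebraicComplexity.asymptoticRank (fun U S T : Finset (Fin n) => if Disjoint S T ∧ U = S ∪ T then (-1 : ℂ) ^ ((S ×ˢ T).filter (fun p : Fin n × Fin n => p.2 < p.1)).card else 0)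

/-- item stmt-MatrixMultiplication-3852 · crux · rank 4 · open · by planner
why it might fail: finite-level obstructions are real and level-dependent (arXiv:2212.01175 p.10: 0 of >10^5 rank-47 ⟨4,4,4⟩ F_2-schemes lift to ℤ/4); near-optimal F̄_2-decompositions of T_{D} may all be obstructed toward T_Λ with a uniform exponent gap, even though e_Λ = 1 holds via non-integral decompositions.
sources: arXiv:2212.01175, doi:10.1038/s41586-022-05172-4, arXiv:1905.10192, BurgisserClausenShokrollahi1997, arXiv:1804.09448
[crux] 2-adic Hensel lifting with sub-exponential padding (card items N1/B1 transplanted to the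
exterior algebra, where the special fibre is solved): for every ε > 0 and all large n there is N ≥ 1
with R_{Z̄_2}(T_{Λ_n}^{⊠N}) ≤ 2^{(1+ε)nN}, the rank taken over the valuation ring Z̄_2 of Q̄_2
(2-adically integral decompositions; their reductions are F̄_2-decompositions of T_{D_{nN}} ⊗ F_2,
which exist in rank ≤ (nN+1)(nN+2)/2·2^{nN}). Mechanism: lift order by order 2^s → 2^{s+1}; the
obstruction at each order is the class of (T_Λ − Φ(D̃))/2^s in coker dΦ_D over the residue field,
killed by re-choosing lower-order lifts and by padding; implies ExteriorExponentOne (support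
HenselToExponent). [difficulty: XL] -/
@[route_item "route-MatrixMultiplication-HenselReesLifting"]
def HenselLiftExterior : Prop :=
  ∀ ε : ℝ, 0 < ε → ∀ᶠ n : ℕ in Filter.atTop, ∃ N : ℕ, 1 ≤ N ∧ (Literature.Computability.AlgebraicComplexity.tensorRank (Literature.Computability.AlgebraicComplexity.kroneckerPow (fun U S T : Finset (Fin n) => if Disjoint S T ∧ U = S ∪ T then (-1 : (PadicAlgCl.valued 2).v.integer) ^ ((S ×ˢ T).filter (fun p : Fin n × Fin n => p.2 < p.1)).card else 0) N) : ℝ) ≤ (2 : ℝ) ^ ((1 + ε) * n * N)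

/-- item stmt-MatrixMultiplication-3853 · crux · rank 5 · open · by planner
why it might fail: optimal decompositions of T_{Λ_n}^{⊠N} sit at very singular points of the secant variety where coker dΦ_D is huge; the order-2 feedback Φ''(D_1,D_1) need not be low-rank modulo the Terracini space for ANY choice of D_1, forcing padding 2^{cnN}, c > 0.
sources: BurgisserClausenShokrollahi1997, Landsberg2017, BlaserLysikov2016, arXiv:1609.07134
[crux] t-adic (Rees) lifting with sub-exponential padding: for every ε > 0, all large n and all
large N, the rank over ℂ[[t]] of the N-th Kronecker power of the Rees tensor T_t(U,S,T) = [U =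
SΔT]·t^{|S∩T|}(−1)^{inv(S,T)} (special fibre T_{Λ_n} at t = 0, generic fibre ≅ T_{Cl_n}) is ≤
2^{εnN}·R_ℂ(T_{Λ_n}^{⊠N}). Implies CliffordReduction by coefficient extraction (support
ReesToReduction: a ℂ[[t]]-decomposition of a degree-D polynomial tensor yields ≤ (D+1)(D+2)/2 triads
per term for its value at t = 1). [difficulty: XL] -/
@[route_item "route-MatrixMultiplication-HenselReesLifting"]
def ReesLiftClifford : Prop :=
  ∀ ε : ℝ, 0 < ε → ∀ᶠ n : ℕ in Filter.atTop, ∀ᶠ N : ℕ in Filter.atTop, (Literature.Computability.AlgebraicComplexity.tensorRank (Literature.Computability.AlgebraicComplexity.kroneckerPow (fun U S T : Finset (Fin n) => if U = symmDiff S T then (PowerSeries.X : PowerSeries ℂ) ^ (S ∩ T).card * (-1 : PowerSeries ℂ) ^ ((S ×ˢ T).filter (fun p : Fin n × Fin n => p.2 < p.1)).card else 0) N) : ℝ) ≤ (2 : ℝ) ^ (ε * n * N) * (Literature.Computability.AlgebraicComplexity.tensorRank (Literature.Computability.AlgebraicComplexity.kroneckerPow (fun U S T : Finset (Fin n) =>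 if Disjoint S T ∧ U = S ∪ T then (-1 : ℂ) ^ ((S ×ˢ T).filter (fun p : Fin n × Fin n => p.2 < p.1)).card else 0) N) : ℝ)

/-- item stmt-MatrixMultiplication-3854 · support · rank 9 · open · by planner
sources: Chevalley1951, arXiv:1609.07134, Blaser2013
[support] Cl_{2k}(ℂ) ≅ M_{2^k}(ℂ) at tensor level: T_{Cl_{2k}} restricts to ⟨2^k,2^k,2^k⟩
(Jordan–Wigner / Pauli strings e_{2j−1} ↦ Z^{⊗(j−1)}⊗X⊗1^{⊗(k−j)}, e_{2j} ↦ Z^{⊗(j−1)}⊗Y⊗1^{⊗(k−j)};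
an algebra isomorphism transports structure tensors by (φ, φ⁻ᵀ, φ⁻ᵀ)). Gives R~(⟨2^k,2^k,2^k⟩) ≤
R~(T_{Cl_{2k}}) by asymptoticRank_le_of_polyDegeneratesTo (PROVED in tree). [difficulty:
provable-now] -/
@[route_item "route-MatrixMultiplication-HenselReesLifting", crux]
def CliffordMatrixModel : Prop :=
  ∀ k : ℕ, Literature.Computability.AlgebraicComplexity.TensorRestrictsTo (fun U S T : Finset (Fin (2 * k)) => if U = symmDiff S T then (-1 : ℂ) ^ ((S ×ˢ T).filter (fun p : Fin (2 * k) × Fin (2 * k) => p.2 < p.1)).card else 0) (Literature.Computability.AlgebraicComplexity.matMulTensor ℂ (2 ^ k) (2 ^ k) (2 ^ k))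

/-- item stmt-MatrixMultiplication-3855 · support · rank 9 · open · by planner
sources: BurgisserClausenShokrollahi1997, Landsberg2017, Blaser2013
[support] the special fibre is solved: over F_2 the reduction of T_{Λ_n} (all signs +1, i.e. T_{D_n}
⊗ F_2 = W^{⊠n}) has rank ≤ (n+1)(n+2)/2·2^n. Proof: εT_{D_1} + ε²e_{x;x,x} = (ε,−1)⊗(1,0)⊗(1,0) +
(0,1)⊗(1,ε)⊗(1,ε) over ℤ[ε] (order-1 approximate decomposition with 2 triads, from ℤ[x]/(x²−εx) ≅
ℤ[1/ε]²); take the n-th Kronecker power and extract the ε^n coefficient: Σ_{a+b≤n} w_a⊗u_b⊗v_{n−a−b}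
per product triad; map ℤ → ZMod 2 (tensorRank_map_le, PROVED). [difficulty: provable-now] -/
@[route_item "route-MatrixMultiplication-HenselReesLifting"]
def SpecialFibreSolved : Prop :=
  ∀ n : ℕ, Literature.Computability.AlgebraicComplexity.tensorRank (fun U S T : Finset (Fin n) => if Disjoint S T ∧ U = S ∪ T then (1 : ZMod 2) else 0) ≤ (n + 1) * (n + 2) / 2 * 2 ^ n

/-- item stmt-MatrixMultiplication-3856 · support · rank 9 · open · by planner
sources: BurgisserClausenShokrollahi1997, Blaser1999
[support] HenselLiftExterior → ExteriorExponentOne: push a Z̄_2-decomposition along Z̄_2 ⊂ Q̄_2 ≃+*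
ℂ (tree:
Literature.NumberTheory.GaloisRepresentations.NumberField.nonempty_algebraicClosure_padic_ringEquiv_complex,
PROVED; tensorRank_map_le, PROVED; the image of T_{Λ_n} is T_{Λ_n} since entries are 0, ±1, and
kroneckerPow commutes with ring maps), then R~(t) ≤ R(t^{⊠N})^{1/N} (asymptoticRank_le_rpow,
PROVED). [difficulty: provable-now] -/
@[route_item "route-MatrixMultiplication-HenselReesLifting"]
def HenselToExponent : Prop :=
  HenselLiftExterior → ExteriorExponentOne

/-- item stmt-MatrixMultiplication-3857 · support · rank 9 · open · by planner
sources: BurgisserClausenShokrollahi1997, Blaser2013, AlmanDuanVassilevskaWilliamsXuXuZhou2025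
[support] ReesLiftClifford → CliffordReduction: a rank-r decomposition over ℂ[[t]] of a tensor whose
entries are polynomials of degree ≤ D = nN gives, by comparing coefficients of t^j (j ≤ D) and
regrouping Σ_{a+b≤D} w_a⊗u_b⊗(Σ_{c≤D−a−b} v_c), a decomposition of its value at t = 1 — which is
T_{Cl_n}^{⊠N} — with ≤ (D+1)(D+2)/2·r triads (Bini's argument, valid over any ring); then N-th roots
and the Fekete limit advxxz2025_asymptoticRank_tendsto (PROVED) on both sides, (nN+2)^{2/N} → 1.
[difficulty: provable-now] -/
@[route_item "route-MatrixMultiplication-HenselReesLifting"]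
def ReesToReduction : Prop :=
  ReesLiftClifford → CliffordReduction

/-- item stmt-MatrixMultiplication-3858 · assembly · rank 1 · open · by planner
sources: Blaser2013, AlmanDuanVassilevskaWilliamsXuXuZhou2025, BurgisserClausenShokrollahi1997
[assembly] ExteriorExponentOne → CliffordReduction → CliffordMatrixModel → MatrixMultiplication
(ω(ℂ) = 2). -/
@[route_item "route-MatrixMultiplication-HenselReesLifting"]
def Assembly : Prop :=
  ExteriorExponentOne → CliffordReduction → CliffordMatrixModel → MatrixMultiplication

/-! D-0027 §2.1 — DECIDING THEOREM (planner-authored via `route open/edit --closes-file`; by planner-rbadge-MatrixMultiplication-HenselRees-5aa9c5bd-g2-0 2026-08-15T16:14:25Z):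
its hypotheses are this route's items and its conclusion the sub-problem Statement (glue_lint), and it elaborates with this file. -/

@[closes "route-MatrixMultiplication-HenselReesLifting"] theorem closes (hA : ExteriorExponentOne) (hB : CliffordReduction) (hM : CliffordMatrixModel) : MatrixMultiplication := by
  -- Route glue (D-0027 §2.1): for every δ > 0 take ε = δ/4 and an even size n = 2k beyond both
  -- eventual bounds; then (2^k)^ω ≤ R~(⟨2^k,2^k,2^k⟩) (rpow_omega_le_asymptoticRank_matMulTensor)
  -- ≤ R~(T_{Cl_{2k}}) (CliffordMatrixModel, restriction ⇒ degeneration ⇒ R~ monotone)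
  -- ≤ 2^{2kε}·R~(T_{Λ_{2k}}) (CliffordReduction) ≤ 2^{2kε}·2^{(1+ε)2k} (ExteriorExponentOne)
  -- = 2^{k(2+δ)}, so k·ω ≤ k(2+δ), ω ≤ 2 + δ; with ω ≥ 2 (omega_two_le) this is ω(ℂ) = 2.
  rw [MatrixMultiplication_iff]
  refine le_antisymm ?_ (Literature.Computability.AlgebraicComplexity.omega_two_le ℂ)
  refine le_of_forall_pos_le_add fun δ hδ => ?_
  have hε : (0 : ℝ) < δ / 4 := by positivity
  obtain ⟨N, hN⟩ := Filter.eventually_atTop.1 ((hA (δ / 4) hε).and (hB (δ / 4) hε))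
  obtain ⟨k, hk1, hn⟩ : ∃ k : ℕ, 1 ≤ k ∧ N ≤ 2 * k := ⟨N + 1, Nat.succ_pos N, by omega⟩
  obtain ⟨hAn, hBn⟩ := hN (2 * k) hn
  have h1 : (((2 ^ k : ℕ)) : ℝ) ^ Literature.Computability.AlgebraicComplexity.omega ℂ ≤
      Literature.Computability.AlgebraicComplexity.asymptoticRank
        (Literature.Computability.AlgebraicComplexity.matMulTensor ℂ (2 ^ k) (2 ^ k) (2 ^ k)) :=
    Literature.Computability.AlgebraicComplexity.rpow_omega_le_asymptoticRank_matMulTensor ℂ (2 ^ k)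
  have h2 : Literature.Computability.AlgebraicComplexity.asymptoticRank
        (Literature.Computability.AlgebraicComplexity.matMulTensor ℂ (2 ^ k) (2 ^ k) (2 ^ k)) ≤
      Literature.Computability.AlgebraicComplexity.asymptoticRank
        (fun U S T : Finset (Fin (2 * k)) => if U = symmDiff S T then (-1 : ℂ) ^ ((S ×ˢ T).filter (fun p : Fin (2 * k) × Fin (2 * k) => p.2 < p.1)).card else 0) :=
    Literature.Barriers.MatrixMultiplication.asymptoticRank_le_of_polyDegeneratesTo (hM k).polyDegeneratesTo
  have h3 := h1.trans (h2.trans (hBn.trans (mul_le_mul_of_nonneg_left hAn (by positivity))))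
  rw [← Real.rpow_add (by norm_num : (0 : ℝ) < 2)] at h3
  have h4 : ((2 ^ k : ℕ) : ℝ) ^ Literature.Computability.AlgebraicComplexity.omega ℂ =
      (2 : ℝ) ^ ((k : ℝ) * Literature.Computability.AlgebraicComplexity.omega ℂ) := by
    push_cast
    rw [← Real.rpow_natCast, ← Real.rpow_mul (by norm_num : (0 : ℝ) ≤ 2)]
  rw [h4, Real.rpow_le_rpow_left_iff (by norm_num : (1 : ℝ) < 2)] at h3
  push_cast at h3
  have hk0 : (0 : ℝ) < k := by exact_mod_cast hk1
  by_contra hcon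
  have h5 : (k : ℝ) * (2 + δ) < k * Literature.Computability.AlgebraicComplexity.omega ℂ :=
    mul_lt_mul_of_pos_left (not_le.1 hcon) hk0
  linarith

end Summit.MatrixMultiplication.MatrixMultiplication.Theses.HenselReesLifting
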